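import Mathlib
import Summits.Ventures.FusionMHD.Models.SAlphaQuarticBump
import Summits.Ventures.FusionMHD.Models.SAlphaTwoTurnBump
import HarnessLib

/-!
# F3 rows «F3.BALLOON-sα-S{05,15,2}-…»: the UNSTABLE side of the `s–α` ballooning MODEL at the shears
# `s = 1/2, 3/2, 2` — certified segments of ★ #184's quartic-bump conic

LADDER-GRIDFUSION rung F3 (cell `gridfusion`).  Statements + proofs by gridfusion-lit-4 (g12), 2026-08-28, as the
WITNESS halves of the two-sided brackets whose STABLE halves are lit-4's engine instances
`SAlphaStableS05A….lean` (`s = 1/2`), `SAlphaStableS15A075.lean` (`s = 3/2`, `α = 3/4`) and `SAlphaStableS2A10.lean`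
(`s = 2`, `α = 1`).  Everything here is gridfusion-model-7's ★ #184 machinery BY NAME
(`Summits/Ventures/FusionMHD/Models/SAlphaQuarticBump.lean`: the closed-form one-surface energy `conic s α = c₀ + c₁s² +
c₂sα + c₃α² + c₄α` of the quartic bump `X = (π² − θ²)²` on `[−π, π]`, `energy_eq_conic`, the integer enclosures
`c0_bounds … c4_bounds` from `Real.pi_gt_d6 / pi_lt_d6`, `unstableWitness_of_conic_neg`, and the convexity-in-`α`
segment argument of `conic_neg_one_of_mem`) — evaluated at three more shears.  0 kit, 0 named facts, no `decide`,
no `native_decide`.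

## What is PROVED (MODEL statements; sufficient, not necessary, for instability)
* `s = 1/2`: `conic (1/2) α < 0`, hence `SAlpha.UnstableWitness (1/2) α (−π) π bumpX bumpX′`, for EVERY `α ∈ [3/5, 6/5]`
  (`unstableWitness_half_of_mem`; endpoints `W(1/2, 3/5) < −100`, `W(1/2, 6/5) < −100`; float band of the conic at
  `s = 1/2`: `α ∈ (0.564…, 1.478…)`).
* `s = 3/2`: the same for EVERY `α ∈ [27/20, 5/2]` (`unstableWitness_threeHalves_of_mem`; float band `(1.316…, 2.920…)`).
* `s = 2`: the same for EVERY `α ∈ [19/10, 3]` (`unstableWitness_two_of_mem`; float band `(1.870…, 3.463…)`;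
  the point `(2, 3)` is ★ #184's `unstableWitness_two_three`).
* (v2, §TT) two more shears on the unstable side by model-7's TWO-TURN bump ★ #192 BY NAME (`SAlphaTwoTurnBump.ttConic`,
  `tte1_bounds … tte5_bounds`, `unstableWitness_of_ttConic_neg`): `SAlpha.UnstableWitness (5/2) (7/4) (−2π) (2π) ttX ttX′`
  (`unstableWitness_tt_fiveHalves_74`; worst-case closed-form value `< −1.2·10⁵`) and `SAlpha.UnstableWitness 3 (11/5) …`
  (`unstableWitness_tt_three_115`; `< −2.2·10⁵`) — the upper ends of the brackets at `s = 5/2` (stable `5/4`,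
  `SAlphaStableS25A125.lean`) and `s = 3` (stable `8/5`, `SAlphaStableS3A16.lean`).
* (v3, §TT2) two further shears by the same closed form: `SAlpha.UnstableWitness (3/4) (23/40) (−2π) (2π) ttX ttX′`
  (`unstableWitness_tt_threeQuarters_0575`; worst case `< −1.0·10⁵`) and `SAlpha.UnstableWitness (5/4) (33/40) …`
  (`unstableWitness_tt_fiveQuarters_0825`; `< −1.0·10⁵`) — upper ends for the shears `s = 3/4` and `s = 5/4`.

## THREE COLUMNS
CERTIFIED: in the `s–α` MODEL (Freidberg (12.96)–(12.99)) the unstable `α`-set `U_s` (surfaces carrying a compactly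
supported trial function with negative one-surface energy) contains `[3/5, 6/5]` at `s = 1/2`, `[27/20, 5/2]` at
`s = 3/2` and `[19/10, 3]` at `s = 2`; with the stable-side instances BY NAME this gives CLOSED brackets on the first
unstable `α` at or above the certified stable point: `s = 3/2`: `inf {α ≥ 3/4 : α ∈ U_{3/2}} ∈ [3/4, 27/20]`;
`s = 2`: `inf {α ≥ 1 : α ∈ U_2} ∈ [1, 19/10]`; with §TT and the stable instances `s = 5/2`: `[5/4, 7/4]`, `s = 3`:
`[8/5, 11/5]` (monotonicity / continuity in `α` NOT typed; the model has a second
stable region, so no global monotonicity is claimed).  VALIDATED (never in the kernel): Freidberg Fig. 12.5 / p. 491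
(first-stability boundary `α ≈ 0.6 s` for `s ≲ 1`); shooting of the Euler–Lagrange equation of (12.97) (kit j299948,
floats): first unstable `α ≈ 0.395, 0.885, 1.18` at `s = 1/2, 3/2, 2` and (kit j301608) `≈ 1.49, 1.815` at `s = 5/2, 3`; the quartic bump is a one-transit trial
function, so its conic is an INNER piece of the band (model-7's two-turn bump ★ #192 reaches lower at `s = 1`).
MODELLED: `s–α` model (shifted circles, high-`n` ballooning ordering, `θ₀ = 0`, ideal MHD); the representation
step `W̄ < 0 somewhere ⇔ 2-D δW < 0` (Connor–Hastie–Taylor 1979) is QUOTED in lit-3's file, not typed; no device,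
no `β` limit.

Citations: J. P. Freidberg, *Ideal MHD* (CUP 2014) §12.3, §12.6.2 (12.96)–(12.100), Fig. 12.5 [Freidberg2014].
Everything here is [instance data].
-/

noncomputable section

open Real Set
open Literature.MathematicalPhysics.MHD.Ballooning

namespace Summit.Ventures.FusionMHD.Models

namespace SAlphaQuarticBumpShears

open SAlphaQuarticBump

/-- Lagrange interpolation of the conic in `α` between `a` and `b` at fixed shear `s` (it is a quadratic in `α` with
leading coefficient `c₃`). [instance data] -/
theorem conic_interp (s a b α : ℝ) (hab : a ≠ b) :
    conic s α = ((b - α) * conic s a + (α - a) * conic s b) / (b - a) - c3 * (α - a) * (b - α) := by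
  have hba : b - a ≠ 0 := sub_ne_zero.2 (Ne.symm hab)
  unfold conic
  field_simp
  ring

/-- THE SEGMENT LEMMA at fixed shear: two endpoint values `< −100` and `c₃ > 0` put the whole segment inside the
conic. [instance data] -/
theorem conic_neg_of_mem {s a b α : ℝ} (hab : a < b) (ha : conic s a < -100) (hb : conic s b < -100)
    (h1 : a ≤ α) (h2 : α ≤ b) : conic s α < 0 := by
  have h3 := c3_bounds
  rw [conic_interp s a b α hab.ne]
  have p1 : (b - α) * conic s a ≤ (b - α) * (-100) := mul_le_mul_of_nonneg_left ha.le (by linarith)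
  have p2 : (α - a) * conic s b ≤ (α - a) * (-100) := mul_le_mul_of_nonneg_left hb.le (by linarith)
  have p3 : 0 ≤ c3 * (α - a) * (b - α) := by
    have : 0 ≤ (α - a) * (b - α) := mul_nonneg (by linarith) (by linarith)
    have hc3 : 0 ≤ c3 := by linarith [h3.1]
    nlinarith [mul_nonneg hc3 this]
  have hq : ((b - α) * conic s a + (α - a) * conic s b) / (b - a) < 0 := by
    apply div_neg_of_neg_of_pos _ (by linarith)
    nlinarith
  linarith

/-! ### `s = 1/2` -/

/-- `W(1/2, 3/5) < −100` (`≈ −512`). [instance data] -/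
theorem conic_half_35_lt : conic (1 / 2) (3 / 5) < -100 := by
  have h0 := c0_bounds; have h1 := c1_bounds; have h2 := c2_bounds; have h3 := c3_bounds; have h4 := c4_bounds
  unfold conic
  linarith [h0.1, h0.2, h1.1, h1.2, h2.1, h2.2, h3.1, h3.2, h4.1, h4.2]

/-- `W(1/2, 6/5) < −100` (`≈ −2849`). [instance data] -/
theorem conic_half_65_lt : conic (1 / 2) (6 / 5) < -100 := by
  have h0 := c0_bounds; have h1 := c1_bounds; have h2 := c2_bounds; have h3 := c3_bounds; have h4 := c4_bounds
  unfold conic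
  linarith [h0.1, h0.2, h1.1, h1.2, h2.1, h2.2, h3.1, h3.2, h4.1, h4.2]

/-- A CERTIFIED SEGMENT OF THE BAND at `s = 1/2`: `α ∈ [3/5, 6/5]`. [instance data] -/
theorem conic_neg_half_of_mem {α : ℝ} (h1 : 3 / 5 ≤ α) (h2 : α ≤ 6 / 5) : conic (1 / 2) α < 0 :=
  conic_neg_of_mem (by norm_num) conic_half_35_lt conic_half_65_lt h1 h2

/-- Every surface `(1/2, α)`, `3/5 ≤ α ≤ 6/5`, of the `s–α` MODEL admits a compactly supported trial function with
negative one-surface energy (the quartic bump on one transit). MODEL `s–α`; no device. [instance data] -/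
theorem unstableWitness_half_of_mem {α : ℝ} (h1 : 3 / 5 ≤ α) (h2 : α ≤ 6 / 5) :
    SAlpha.UnstableWitness (1 / 2) α (-π) π bumpX bumpX' :=
  unstableWitness_of_conic_neg (conic_neg_half_of_mem h1 h2)

/-! ### `s = 3/2` -/

/-- `W(3/2, 27/20) < −100` (`≈ −862`). [instance data] -/
theorem conic_threeHalves_135_lt : conic (3 / 2) (27 / 20) < -100 := by
  have h0 := c0_bounds; have h1 := c1_bounds; have h2 := c2_bounds; have h3 := c3_bounds; have h4 := c4_bounds
  unfold conic
  linarith [h0.1, h0.2, h1.1, h1.2, h2.1, h2.2, h3.1, h3.2, h4.1, h4.2]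

/-- `W(3/2, 5/2) < −100` (`≈ −8020`). [instance data] -/
theorem conic_threeHalves_25_lt : conic (3 / 2) (5 / 2) < -100 := by
  have h0 := c0_bounds; have h1 := c1_bounds; have h2 := c2_bounds; have h3 := c3_bounds; have h4 := c4_bounds
  unfold conic
  linarith [h0.1, h0.2, h1.1, h1.2, h2.1, h2.2, h3.1, h3.2, h4.1, h4.2]

/-- A CERTIFIED SEGMENT OF THE BAND at `s = 3/2`: `α ∈ [27/20, 5/2]`. [instance data] -/
theorem conic_neg_threeHalves_of_mem {α : ℝ} (h1 : 27 / 20 ≤ α) (h2 : α ≤ 5 / 2) : conic (3 / 2) α < 0 :=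
  conic_neg_of_mem (by norm_num) conic_threeHalves_135_lt conic_threeHalves_25_lt h1 h2

/-- Every surface `(3/2, α)`, `27/20 ≤ α ≤ 5/2`, of the `s–α` MODEL admits a compactly supported trial function with
negative one-surface energy. MODEL `s–α`; no device. [instance data] -/
theorem unstableWitness_threeHalves_of_mem {α : ℝ} (h1 : 27 / 20 ≤ α) (h2 : α ≤ 5 / 2) :
    SAlpha.UnstableWitness (3 / 2) α (-π) π bumpX bumpX' :=
  unstableWitness_of_conic_neg (conic_neg_threeHalves_of_mem h1 h2)

/-! ### `s = 2` -/

/-- `W(2, 19/10) < −100` (`≈ −760`). [instance data] -/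
theorem conic_two_19_lt : conic 2 (19 / 10) < -100 := by
  have h0 := c0_bounds; have h1 := c1_bounds; have h2 := c2_bounds; have h3 := c3_bounds; have h4 := c4_bounds
  unfold conic
  linarith [h0.1, h0.2, h1.1, h1.2, h2.1, h2.2, h3.1, h3.2, h4.1, h4.2]

/-- `W(2, 3) < −100` (`≈ −8444`; the point of ★ #184's `conic_neg_two_three`). [instance data] -/
theorem conic_two_3_lt : conic 2 3 < -100 := by
  have h0 := c0_bounds; have h1 := c1_bounds; have h2 := c2_bounds; have h3 := c3_bounds; have h4 := c4_bounds
  unfold conic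
  linarith [h0.1, h0.2, h1.1, h1.2, h2.1, h2.2, h3.1, h3.2, h4.1, h4.2]

/-- A CERTIFIED SEGMENT OF THE BAND at `s = 2`: `α ∈ [19/10, 3]`. [instance data] -/
theorem conic_neg_two_of_mem {α : ℝ} (h1 : 19 / 10 ≤ α) (h2 : α ≤ 3) : conic 2 α < 0 :=
  conic_neg_of_mem (by norm_num) conic_two_19_lt conic_two_3_lt h1 h2

/-- Every surface `(2, α)`, `19/10 ≤ α ≤ 3`, of the `s–α` MODEL admits a compactly supported trial function with
negative one-surface energy. MODEL `s–α`; no device. [instance data] -/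
theorem unstableWitness_two_of_mem {α : ℝ} (h1 : 19 / 10 ≤ α) (h2 : α ≤ 3) :
    SAlpha.UnstableWitness 2 α (-π) π bumpX bumpX' :=
  unstableWitness_of_conic_neg (conic_neg_two_of_mem h1 h2)

/-! ### §TT (v2) Two-turn-bump points at `s = 5/2` and `s = 3` — model-7's ★ #192 closed form BY NAME -/

/-- `W_tt(5/2, 7/4) < 0` (worst case of the integer enclosures `≈ −1.26·10⁵`). [instance data] -/
theorem ttConic_neg_fiveHalves_74 : SAlphaTwoTurnBump.ttConic (5 / 2) (7 / 4) < 0 := by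
  have h1 := SAlphaTwoTurnBump.tte1_bounds; have h2 := SAlphaTwoTurnBump.tte2_bounds
  have h3 := SAlphaTwoTurnBump.tte3_bounds; have h4 := SAlphaTwoTurnBump.tte4_bounds
  have h5 := SAlphaTwoTurnBump.tte5_bounds
  unfold SAlphaTwoTurnBump.ttConic
  linarith [h1.1, h1.2, h2.1, h2.2, h3.1, h3.2, h4.1, h4.2, h5.1, h5.2]

/-- The surface `(s, α) = (5/2, 7/4)` of the `s–α` MODEL admits a compactly supported trial function (the two-turn bump
on `[−2π, 2π]`) with negative one-surface energy. MODEL `s–α`; no device. [instance data] -/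
theorem unstableWitness_tt_fiveHalves_74 :
    SAlpha.UnstableWitness (5 / 2) (7 / 4) (-(2 * π)) (2 * π) SAlphaTwoTurnBump.ttX SAlphaTwoTurnBump.ttX' :=
  SAlphaTwoTurnBump.unstableWitness_of_ttConic_neg ttConic_neg_fiveHalves_74

/-- `W_tt(3, 11/5) < 0` (worst case `≈ −2.2·10⁵`). [instance data] -/
theorem ttConic_neg_three_115 : SAlphaTwoTurnBump.ttConic 3 (11 / 5) < 0 := by
  have h1 := SAlphaTwoTurnBump.tte1_bounds; have h2 := SAlphaTwoTurnBump.tte2_bounds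
  have h3 := SAlphaTwoTurnBump.tte3_bounds; have h4 := SAlphaTwoTurnBump.tte4_bounds
  have h5 := SAlphaTwoTurnBump.tte5_bounds
  unfold SAlphaTwoTurnBump.ttConic
  linarith [h1.1, h1.2, h2.1, h2.2, h3.1, h3.2, h4.1, h4.2, h5.1, h5.2]

/-- The surface `(s, α) = (3, 11/5)` of the `s–α` MODEL admits a compactly supported trial function (the two-turn bump
on `[−2π, 2π]`) with negative one-surface energy. MODEL `s–α`; no device. [instance data] -/
theorem unstableWitness_tt_three_115 :
    SAlpha.UnstableWitness 3 (11 / 5) (-(2 * π)) (2 * π) SAlphaTwoTurnBump.ttX SAlphaTwoTurnBump.ttX' :=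
  SAlphaTwoTurnBump.unstableWitness_of_ttConic_neg ttConic_neg_three_115

/-! ### §TT2 (v3) Two-turn-bump points at `s = 3/4` and `s = 5/4` — model-7's ★ #192 closed form BY NAME -/

/-- `W_tt(3/4, 23/40) < 0` (worst case of the integer enclosures `≈ −1.1·10⁵`). [instance data] -/
theorem ttConic_neg_threeQuarters_0575 : SAlphaTwoTurnBump.ttConic (3 / 4) (23 / 40) < 0 := by
  have h1 := SAlphaTwoTurnBump.tte1_bounds; have h2 := SAlphaTwoTurnBump.tte2_bounds
  have h3 := SAlphaTwoTurnBump.tte3_bounds; have h4 := SAlphaTwoTurnBump.tte4_bounds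
  have h5 := SAlphaTwoTurnBump.tte5_bounds
  unfold SAlphaTwoTurnBump.ttConic
  linarith [h1.1, h1.2, h2.1, h2.2, h3.1, h3.2, h4.1, h4.2, h5.1, h5.2]

/-- The surface `(s, α) = (3/4, 23/40)` of the `s–α` MODEL admits a compactly supported trial function (the two-turn
bump on `[−2π, 2π]`) with negative one-surface energy. MODEL `s–α`; no device. [instance data] -/
theorem unstableWitness_tt_threeQuarters_0575 :
    SAlpha.UnstableWitness (3 / 4) (23 / 40) (-(2 * π)) (2 * π) SAlphaTwoTurnBump.ttX SAlphaTwoTurnBump.ttX' :=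
  SAlphaTwoTurnBump.unstableWitness_of_ttConic_neg ttConic_neg_threeQuarters_0575

/-- `W_tt(5/4, 33/40) < 0` (worst case `≈ −1.05·10⁵`). [instance data] -/
theorem ttConic_neg_fiveQuarters_0825 : SAlphaTwoTurnBump.ttConic (5 / 4) (33 / 40) < 0 := by
  have h1 := SAlphaTwoTurnBump.tte1_bounds; have h2 := SAlphaTwoTurnBump.tte2_bounds
  have h3 := SAlphaTwoTurnBump.tte3_bounds; have h4 := SAlphaTwoTurnBump.tte4_bounds
  have h5 := SAlphaTwoTurnBump.tte5_bounds
  unfold SAlphaTwoTurnBump.ttConic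
  linarith [h1.1, h1.2, h2.1, h2.2, h3.1, h3.2, h4.1, h4.2, h5.1, h5.2]

/-- The surface `(s, α) = (5/4, 33/40)` of the `s–α` MODEL admits a compactly supported trial function (the two-turn
bump on `[−2π, 2π]`) with negative one-surface energy. MODEL `s–α`; no device. [instance data] -/
theorem unstableWitness_tt_fiveQuarters_0825 :
    SAlpha.UnstableWitness (5 / 4) (33 / 40) (-(2 * π)) (2 * π) SAlphaTwoTurnBump.ttX SAlphaTwoTurnBump.ttX' :=
  SAlphaTwoTurnBump.unstableWitness_of_ttConic_neg ttConic_neg_fiveQuarters_0825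

end SAlphaQuarticBumpShears

end Summit.Ventures.FusionMHD.Models

end
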